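import Summits.QuantumFields.BalabanUV.T4Continuum.Support.NE7MinimiserC1AllData
import Summits.QuantumFields.BalabanUV.T4Continuum.Support.NE7StabiliserLiftingUniform
import HarnessLib

/-!
# NE7MinimiserC1AllDataUniform — ✓ `NE7MinimiserC1AllData` (road t4-ne7-p1 gen 115, ROAD-G115 §1) RE-ASSEMBLED WITH THE LEVEL-UNIFORM STABILISER LIFTING
# ✓ `NE7StabiliserLiftingUniform.stabiliser_lifting_uniform` (row NE7b gen 159, ROAD-G115 §5 (iv)): THE DATUM RADIUS `δ_V` NO LONGER SHRINKS WITH THE LEVEL — `∃ δ_V ∀ j`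

Cell `pub-balaban`, rung (B)+1 sub-cell t4, lineage `b2b-balaban-t4-ne7b-p1` (row NE7b OWNER + CRUX PROVER; junction service for row NE7, ruling R-OWNER-149-1 (2)), generation 159 —
filed ON BEHALF OF the road t4-ne7-p1 (its ten-line re-assembly, announced in [NE7bP1-G159-INBOX-1]; the road may cite or supersede this leaf).  Index `t4/b2b-balaban-t4-ne7b-p1/g159/INDEX.md`.
THE RE-ASSEMBLY.  The road's proof of ✓ `NE7MinimiserC1AllData.minimiser_contDiffAt_allData` takes `δ_V = min(δ₁, δ₂, δ₃)` with `δ₁` (existence of minimisers, ✓ `NE7MinimalOrbitDatumContinuity.thresholds`)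
and `δ₂` (the `C¹` lift, ✓ `NE7MinimiserC1Lift.minimiser_contDiffAt_of_lift`) ALREADY uniform in the level and only `δ₃` (✓ p824904 `NE7StabiliserLifting.stabiliser_lifting`, `∀ k ∃ δ_V`)
level-dependent; replacing the last by ✓ p830442 `NE7StabiliserLiftingUniform.stabiliser_lifting_uniform` (`∃ δ_V ∀ k`) moves `∃ δ_V` in front of `∀ j` — verbatim otherwise.
WHAT ([folklore]; 0 def, 0 sorry; `d = 4`, every `U(n)`, `L ≥ 2`).  **`minimiser_contDiffAt_allData_uniform`**, **`minAct_contDiffAt_allData_uniform`**: the statements of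
✓ `NE7MinimiserC1AllData.minimiser_contDiffAt_allData` ∕ `minAct_contDiffAt_allData` with `∀ j ∃ δ_V` replaced by `∃ δ_V ∀ j`.
HONEST FRAMING (page 1): composition of landed kernel theorems; radii∕constants existential (depend on `ε`, `n`, `N`, `L` — NOT on the level `j`, NOT on `V₀`); the statement is CENTRED
at `V₀` (a `C¹` germ at each small datum), not a global `C¹` section; `C¹`, NOT the analyticity [B11] p. 279 asserts; OUR minimisers (B11 (8) with `sfClass`), OUR route, NOT Bałaban's
method; nothing of Bałaban's asserted; NOT NE7 as a spine node, NOT NE3; row NE7b NOT PRINTED ∕ NOT PROVED; spine 0∕9; finite T⁴ rung (B)+1 — NOT infinite volume, NOT mass gap, NOT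
BetaPertH, NOT Clay (continuum YM on T⁴ ⇐ BetaPertH ∧ nine spine estimates).
-/

set_option autoImplicit false

open scoped BigOperators Matrix Matrix.Norms.L2Operator Topology
open NormedSpace Finset Set Filter Metric

namespace Summit.QuantumFields.BalabanUV.T4Continuum.NE7MinimiserC1AllDataUniform

open Literature.MathematicalPhysics.QuantumFieldTheory.Balaban1983to89
open B7Prop1Explicit B7Prop2Explicit
open T4AveragingDeficitWall (IsUnitaryCfg SmallField)
open T4AveragingDeficitWallBoundary (IsPeriodicCfg)
open AveragingDeficitTorusChart (TDir chart)
open AveragingDeficitTwoLevelPrep (skewSub)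
open AveragingDeficitMultiLevelPrep (tower)
open MinimalActionSandwich (IsMinimiser minAct)
open MinimalActionRate (sfClass)
open NE3EnergyShapes (IsUnitarySite IsPeriodicSite)
open NE7MinimalOrbitDatumContinuity (thresholds)
open NE7MinimiserC1Lift (minimiser_contDiffAt_of_lift)
open NE7StabiliserLiftingUniform (stabiliser_lifting_uniform)

noncomputable section

variable {n : Type} [Fintype n] [DecidableEq n]

/-- **`U_k(V)` IS `C¹` IN `V` AT EVERY SMALL DATUM, WITH ONE DATUM RADIUS FOR ALL LEVELS**: for `ε ≤ ε₀` and `N ≥ 1` there is `δ_V > 0` such that FOR EVERY level `j+1` every unitary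
`N`-periodic `δ_V`-small datum `V₀` carries minimisers, and around EVERY minimiser `U♯` over `V₀` there is a local section `y ↦ chart_{U♯} Ψ(y)` of minimisers over `chart_{V₀} y`,
`Ψ` of class `C¹` at `0` with `Ψ 0 = 0`, and `y ↦ minAct(chart_{V₀} y)` is `C¹` at `0` — ✓ `NE7MinimiserC1AllData.minimiser_contDiffAt_allData` with `∃ δ_V ∀ j`. [folklore] -/
theorem minimiser_contDiffAt_allData_uniform [Nonempty n] {L : ℕ} [NeZero L] (hL : 2 ≤ L) :
    ∃ ε₀ : ℝ, 0 < ε₀ ∧ ∀ ε : ℝ, 0 < ε → ε ≤ ε₀ → ∀ (N : ℕ) [NeZero N], 1 ≤ N → ∃ δV : ℝ, 0 < δV ∧ ∀ j : ℕ,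
        ∀ V₀ ∈ {V : Site 4 → Fin 4 → (Matrix n n ℂ)ˣ | IsUnitaryCfg V ∧ IsPeriodicCfg V (N : ℤ) ∧ SmallField V δV},
        (∃ Us : Site 4 → Fin 4 → (Matrix n n ℂ)ˣ, IsMinimiser 4 (sfClass 4 L N ε) L N (j + 1) V₀ Us) ∧
        ∀ Us : Site 4 → Fin 4 → (Matrix n n ℂ)ˣ, IsMinimiser 4 (sfClass 4 L N ε) L N (j + 1) V₀ Us →
        ∃ Ψ : ↥(skewSub 4 n N) → ↥(skewSub 4 n (L * tower L N j)), ContDiffAt ℝ 1 Ψ 0 ∧ Ψ 0 = 0 ∧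
          (∀ᶠ y : ↥(skewSub 4 n N) in 𝓝 0, IsMinimiser 4 (sfClass 4 L N ε) L N (j + 1) (chart (ContinuousLinearMap.id ℝ (Matrix n n ℂ)) N V₀ (y : TDir 4 n N))
            (chart (ContinuousLinearMap.id ℝ (Matrix n n ℂ)) (L * tower L N j) Us ((Ψ y : ↥(skewSub 4 n (L * tower L N j))) : TDir 4 n (L * tower L N j)))) ∧
          ContDiffAt ℝ 1 (fun y : ↥(skewSub 4 n N) => minAct 4 (sfClass 4 L N ε) L N (j + 1) (chart (ContinuousLinearMap.id ℝ (Matrix n n ℂ)) N V₀ (y : TDir 4 n N))) 0 := by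
  obtain ⟨ε₁, hε₁, H⟩ := thresholds (n := n) hL
  obtain ⟨ε₂, hε₂, H2⟩ := minimiser_contDiffAt_of_lift (n := n) hL
  obtain ⟨ε₃, hε₃, H3⟩ := stabiliser_lifting_uniform (n := n) hL
  refine ⟨min ε₁ (min ε₂ ε₃), lt_min hε₁ (lt_min hε₂ hε₃), fun ε hε hεle N _ hN => ?_⟩
  obtain ⟨-, -, -, H1⟩ := H ε hε (hεle.trans (min_le_left _ _))
  obtain ⟨δ₁, hδ₁, hint₁⟩ := H1 N hN
  obtain ⟨δ₂, hδ₂, hC1⟩ := H2 ε hε (hεle.trans ((min_le_right _ _).trans (min_le_left _ _))) N hN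
  obtain ⟨δ₃, hδ₃, hlift⟩ := H3 ε hε (hεle.trans ((min_le_right _ _).trans (min_le_right _ _))) N hN
  refine ⟨min δ₁ (min δ₂ δ₃), lt_min hδ₁ (lt_min hδ₂ hδ₃), fun j V₀ hV₀ => ?_⟩
  obtain ⟨hV₀u, hV₀P, hV₀δ⟩ := hV₀
  have hV₀1 : V₀ ∈ {V : Site 4 → Fin 4 → (Matrix n n ℂ)ˣ | IsUnitaryCfg V ∧ IsPeriodicCfg V (N : ℤ) ∧ SmallField V δ₁} :=
    ⟨hV₀u, hV₀P, MinimalActionRate.SmallField.mono hV₀δ (min_le_left _ _)⟩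
  have hV₀2 : V₀ ∈ {V : Site 4 → Fin 4 → (Matrix n n ℂ)ˣ | IsUnitaryCfg V ∧ IsPeriodicCfg V (N : ℤ) ∧ SmallField V δ₂} :=
    ⟨hV₀u, hV₀P, MinimalActionRate.SmallField.mono hV₀δ ((min_le_right _ _).trans (min_le_left _ _))⟩
  have hV₀3 : V₀ ∈ {V : Site 4 → Fin 4 → (Matrix n n ℂ)ˣ | IsUnitaryCfg V ∧ IsPeriodicCfg V (N : ℤ) ∧ SmallField V δ₃} :=
    ⟨hV₀u, hV₀P, MinimalActionRate.SmallField.mono hV₀δ ((min_le_right _ _).trans (min_le_right _ _))⟩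
  refine ⟨?_, fun Us hUs => ?_⟩
  · obtain ⟨U₀, hU₀, -⟩ := hint₁ V₀ hV₀1 (j + 1)
    exact ⟨U₀, hU₀⟩
  · exact hC1 V₀ hV₀2 j Us hUs fun s hsu hsP hsfix => hlift (j + 1) V₀ hV₀3 Us hUs s hsu hsP hsfix

/-- **THE CONSTRAINED MINIMAL ACTION IS `C¹` AT EVERY SMALL DATUM, ONE RADIUS FOR ALL LEVELS** (corollary): for `ε ≤ ε₀`, `N ≥ 1`: `∃ δ_V > 0` such that for every level `j+1` and
every unitary `N`-periodic `δ_V`-small `V₀` the map `y ↦ minAct(chart_{V₀} y)` on `skewSub N` is `C¹` at `0`. [folklore] -/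
theorem minAct_contDiffAt_allData_uniform [Nonempty n] {L : ℕ} [NeZero L] (hL : 2 ≤ L) :
    ∃ ε₀ : ℝ, 0 < ε₀ ∧ ∀ ε : ℝ, 0 < ε → ε ≤ ε₀ → ∀ (N : ℕ) [NeZero N], 1 ≤ N → ∃ δV : ℝ, 0 < δV ∧ ∀ j : ℕ,
        ∀ V₀ ∈ {V : Site 4 → Fin 4 → (Matrix n n ℂ)ˣ | IsUnitaryCfg V ∧ IsPeriodicCfg V (N : ℤ) ∧ SmallField V δV},
          ContDiffAt ℝ 1 (fun y : ↥(skewSub 4 n N) => minAct 4 (sfClass 4 L N ε) L N (j + 1) (chart (ContinuousLinearMap.id ℝ (Matrix n n ℂ)) N V₀ (y : TDir 4 n N))) 0 := by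
  obtain ⟨ε₀, hε₀, H⟩ := minimiser_contDiffAt_allData_uniform (n := n) hL
  refine ⟨ε₀, hε₀, fun ε hε hεle N _ hN => ?_⟩
  obtain ⟨δV, hδV, hall⟩ := H ε hε hεle N hN
  refine ⟨δV, hδV, fun j V₀ hV₀ => ?_⟩
  obtain ⟨⟨Us, hUs⟩, hsec⟩ := hall j V₀ hV₀
  obtain ⟨-, -, -, -, h⟩ := hsec Us hUs
  exact h

end

end Summit.QuantumFields.BalabanUV.T4Continuum.NE7MinimiserC1AllDataUniform
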